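import Summits.BirchSwinnertonDyer.BirchSwinnertonDyer.Theorems.PrintCf2SplitBadTwoRestrictedControlHolds
import Summits.BirchSwinnertonDyer.BirchSwinnertonDyer.Theorems.PrintCf2SplitBadTwoDyadicTorsionOfModel
import HarnessLib

/-!
# STUB-IDEAS k1 g19 — `stub_heegnerIndexLowerAtTwo` (crux `PrintCf2.SplitBadTwoLowerHalfOfFacts`, stmt-BirchSwinnertonDyer-27851)
# Technique family 3 (weaken / strengthen): **R112 EXECUTED FROM THE TREE** — the S3c key table `e_C` is the EXPLICIT witness
# `e_C = e₁ + e₃ + e_v + e_s − e_k − e_Γ = (−2, 0 | 0, 0, 0, −1) = LK − 1 − θ = −E`; `Δ_C = 2`; FLOOR ⟺ `0 ≤ e_A`.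

Seat `sidea-stub_heegnerIndexLowerAtTwo-1` g19 (planner, stub-ideation). SCRATCH CERTIFICATE, not a proposal: no `sorry`, no new
axioms, nothing asserted about BSD — BSD is NOT proved by any of this, and no crux / stub is closed here.

* Part A types the S3c statement of record as a predicate `S3cWith eC` and CERTIFIES the reading against the tree theorem
  `SelmerLocImage.restrictedControl_two_holds` (p684223): `s3c_tree : ∃ eC, S3cWith eC`. The STRONGEST PROVABLE FORM (R112-T) is the
  Prop `S3cExplicit := S3cWith eCtree` with `eCtree` the literal composite of the six tree witnesses (helper-lemma target, typed here).
* Part B is the read-off: `eCtree` values, `e_C = LK − 1 − θ`, the audit law `e_C + E = 0` on all six keys, `Δ_C = 2`, anchor keys.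
* Part C is the member / anchor glue in the critic's v3.6 currency (`m = 2(A+g) + e_A`, `n = B + g + e_C`, S3d⁻ `n′ ≤ n + E`):
  with the calibration `e_C + E = 0` the FLOOR of every key is `0 ≤ e_A`, LOWER ⟸ `0 ≤ e_A`, and at a BSD₂-exact anchor `e_A = −2η`.
* Part D: the two-anchor economy needs no argmax (all keys tie) — in-tree anchors `d₀ = −1, 2, −2` sit on keys `(1,7), (0,1), (0,7)`.
* Part E: R134's budget content is the tree's dyadic torsion theorem (θ = `[d ≡ 3 (8)]` enters `e_C` through F1, `e₁ = 2 − t`).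
-/

set_option linter.dupNamespace false
set_option autoImplicit false

noncomputable section

open scoped Classical

open Field NumberField IsDedekindDomain WeierstrassCurve
open Literature.NumberTheory.EllipticCurves Literature.NumberTheory.EllipticCurves.GreenbergSelmer
open Literature.NumberTheory.EllipticCurves.Agboola2007
open Literature.NumberTheory.EllipticCurves.IwasawaAlgebra
open Literature.NumberTheory.GaloisRepresentations
open Literature.NumberTheory.GaloisCohomology
open Summit.BirchSwinnertonDyer.BirchSwinnertonDyer.Theorems.PrintCf2
open Summit.BirchSwinnertonDyer.BirchSwinnertonDyer.Theorems.GoldfeldGoodTwists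

namespace Summit.BirchSwinnertonDyer.BirchSwinnertonDyer.Cruxes.SplitBadTwoLowerHalfOfFacts.StubIdeasK1G19

/-! ## Part A — S3c as a predicate in the key table; the tree theorem; the explicit target (R112-T) -/

/-- The statement of S3c (`stub_restrictedControl_two`, skeleton v13.x of crux 20368) with the key table `eC` as a PARAMETER:
token-for-token the body of `SelmerLocImage.restrictedControl_two_holds` under `∃ eC`. -/
def S3cWith (eC : ℤ → ℤ → ℤ) : Prop :=
    ∀ (d : ℤ), d ≠ 0 → Squarefree d → d % 4 ≠ 1 →
    ∀ (W : WeierstrassCurve ℚ) [W.IsElliptic] [W.IsGloballyMinimal] (C : VariableChange ℚ),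
      C • W = cm7.quadraticTwist (d : ℚ) → W.analyticRank = 1 →
    ∀ (K : Type) [Field K] [NumberField K], IsImaginaryQuadratic K →
    ∀ (v vbar : HeightOneSpectrum (𝓞 K)),
      ((2 : ℕ) : 𝓞 K) ∈ v.asIdeal → ((2 : ℕ) : 𝓞 K) ∈ vbar.asIdeal → vbar ≠ v →
    ∀ (π : (W.baseChange K).endRing), (π : AddMonoid.End (W.baseChange K).geomPoints) * π = π - 2 →
    ∀ (r : ℤ_[2]), r * r = r - 2 →
      (∀ τ ∈ GreenbergSelmer.inertia v, ∀ x : ↥((W.baseChange K).endEigenPrimaryTorsion 2 π r), τ • x = x ∨ τ • x = -x) →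
    ∀ (κ' : ZpExtension K 2), κ'.IsUnramifiedOutside vbar → ∀ (γ' : absoluteGaloisGroup K), κ'.IsTopGenerator γ' →
    ∀ (D : Agboola2007.RestrictedDualData κ' ↥((W.baseChange K).endEigenPrimaryTorsion 2 π r) vbar γ') (n : ℕ),
      Module.Finite (IwasawaAlgebra 2) D.X → D.HasCharValuationAt n →
    ∀ (P : W.toAffine.Point) (c₀ : ℕ) (ℓ : ℤ),
      ¬ IsOfFinAddOrder P →
      (∀ R : W.toAffine.Point, ∃ (k : ℤ) (T : W.toAffine.Point), IsOfFinAddOrder T ∧ R = k • P + T) →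
      c₀ ≠ 0 → (W.baseChange ℚ_[2]).IsInReductionKernel (c₀ • W.toPadicPoint 2 P) →
      ‖(W.baseChange ℚ_[2]).padicLogPoint (c₀ • W.toPadicPoint 2 P) / (c₀ : ℚ_[2])‖ = (2 : ℝ) ^ (-ℓ) →
      (n : ℤ) = ((padicValNat 2 (Nat.card (AddCommGroup.primaryComponent W.sha 2)) : ℤ)
            + (padicValNat 2 W.tamagawaProduct : ℤ)
            - 2 * (padicValNat 2 W.torsionOrder : ℤ) + 2 * ℓ) + eC (d % 2) ((d / (2 - d % 2)) % 8)

/-- CERTIFIED READING: the tree theorem S3c (p684223) is `∃ eC, S3cWith eC`, by name. -/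
theorem s3c_tree : ∃ eC : ℤ → ℤ → ℤ, S3cWith eC :=
  SelmerLocImage.restrictedControl_two_holds

/-- **THE TREE'S WITNESS, LITERALLY** (`restrictedControl_two_of_locSurj_bv` l.120–125: `eC := eK + ev + es − ek − eΓ`, `eK := e₁ + e₃`):
`e₁` (`hF1_holds`), `e₃ ≡ 0` (`LocalPointImage.hPI_holds`), `ev` (`exists_ev_padicValNat_natCard_localKer_vbar_of_kerC3`),
`es ≡ −1` (`rSurj''_of_locSurj_of_finite`), `ek ≡ 0` (`kerResidual_holds`), `eΓ ≡ 0` (`rTop'_of_locSurj_of_finite`). -/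
def eCtree (i j : ℤ) : ℤ :=
  ((if i = 1 ∧ j = 3 then -1 else 0) + 0)                                        -- eK = e₁ + e₃
    + (if (i = 1 ∧ j = 7) ∨ (i = 0 ∧ (j = 1 ∨ j = 3 ∨ j = 5)) then 1 else 0)    -- ev = v₂ #LK_{v̄}
    + (-1)                                                                      -- es
    - 0                                                                         -- ek
    - 0                                                                         -- eΓ

/-- **R112-T, the STRONGEST PROVABLE FORM of S3c** (helper-lemma TARGET, typed, not proved here): S3c with the explicit table.
Proof route: re-thread the witness-passing lemmas with the fixed functions (card PLAN 2). -/
def S3cExplicit : Prop := S3cWith eCtree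

/-- The explicit form gives back the tree's `∃`-form (typing check of the target's shape). -/
theorem s3c_of_explicit (h : S3cExplicit) : ∃ eC : ℤ → ℤ → ℤ, S3cWith eC := ⟨eCtree, h⟩

/-- The WEAKEST form of S3c SUFFICIENT for LOWER (one-sided, per key): `n ≤ B + g − E(key)`; it follows from the explicit form. -/
def S3cUpperWith (bound : ℤ → ℤ → ℤ) : Prop :=
    ∀ (d : ℤ), d ≠ 0 → Squarefree d → d % 4 ≠ 1 →
    ∀ (W : WeierstrassCurve ℚ) [W.IsElliptic] [W.IsGloballyMinimal] (C : VariableChange ℚ),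
      C • W = cm7.quadraticTwist (d : ℚ) → W.analyticRank = 1 →
    ∀ (K : Type) [Field K] [NumberField K], IsImaginaryQuadratic K →
    ∀ (v vbar : HeightOneSpectrum (𝓞 K)),
      ((2 : ℕ) : 𝓞 K) ∈ v.asIdeal → ((2 : ℕ) : 𝓞 K) ∈ vbar.asIdeal → vbar ≠ v →
    ∀ (π : (W.baseChange K).endRing), (π : AddMonoid.End (W.baseChange K).geomPoints) * π = π - 2 →
    ∀ (r : ℤ_[2]), r * r = r - 2 →
      (∀ τ ∈ GreenbergSelmer.inertia v, ∀ x : ↥((W.baseChange K).endEigenPrimaryTorsion 2 π r), τ • x = x ∨ τ • x = -x) →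
    ∀ (κ' : ZpExtension K 2), κ'.IsUnramifiedOutside vbar → ∀ (γ' : absoluteGaloisGroup K), κ'.IsTopGenerator γ' →
    ∀ (D : Agboola2007.RestrictedDualData κ' ↥((W.baseChange K).endEigenPrimaryTorsion 2 π r) vbar γ') (n : ℕ),
      Module.Finite (IwasawaAlgebra 2) D.X → D.HasCharValuationAt n →
    ∀ (P : W.toAffine.Point) (c₀ : ℕ) (ℓ : ℤ),
      ¬ IsOfFinAddOrder P →
      (∀ R : W.toAffine.Point, ∃ (k : ℤ) (T : W.toAffine.Point), IsOfFinAddOrder T ∧ R = k • P + T) →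
      c₀ ≠ 0 → (W.baseChange ℚ_[2]).IsInReductionKernel (c₀ • W.toPadicPoint 2 P) →
      ‖(W.baseChange ℚ_[2]).padicLogPoint (c₀ • W.toPadicPoint 2 P) / (c₀ : ℚ_[2])‖ = (2 : ℝ) ^ (-ℓ) →
      (n : ℤ) ≤ ((padicValNat 2 (Nat.card (AddCommGroup.primaryComponent W.sha 2)) : ℤ)
            + (padicValNat 2 W.tamagawaProduct : ℤ)
            - 2 * (padicValNat 2 W.torsionOrder : ℤ) + 2 * ℓ) + bound (d % 2) ((d / (2 - d % 2)) % 8)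

theorem s3cUpper_of_with {eC : ℤ → ℤ → ℤ} (h : S3cWith eC) : S3cUpperWith eC := by
  intro d hd0 hsq hd4 W _ _ C hC hrk K _ _ hK v vbar hv hvbar hne π hπ r hr hpin κ' hκ' γ' hγ' D n hDf hDn P c₀ ℓ hP hgen hc₀ hker hlog
  exact (h d hd0 hsq hd4 W C hC hrk K hK v vbar hv hvbar hne π hπ r hr hpin κ' hκ' γ' hγ' D n hDf hDn P c₀ ℓ hP hgen hc₀ hker hlog).le

/-! ## Part B — the READ-OFF (R112): values, `e_C = LK − 1 − θ = −E`, `Δ_C = 2`, anchor keys -/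

/-- The six bad split keys `(d % 2, (d / (2 − d % 2)) % 8)`. -/
def key6 : List (ℤ × ℤ) := [(1, 3), (1, 7), (0, 1), (0, 3), (0, 5), (0, 7)]

/-- The key of a class parameter `d`. -/
def key (d : ℤ) : ℤ × ℤ := (d % 2, (d / (2 - d % 2)) % 8)

/-- `e_C` on a key. -/
def eC (k : ℤ × ℤ) : ℤ := eCtree k.1 k.2

/-- S3d receptacle table of record (STUB-PLAN B20): `E(1,3) = 2`, `E(0,7) = 1`, else `0`. -/
def E (k : ℤ × ℤ) : ℤ := if k = (1, 3) then 2 else if k = (0, 7) then 1 else 0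

/-- Dyadic line-kernel digit `v₂ #LK_{v̄}` (tree: `natCard_localKer_vbar_eq_one/two_of_frame…`): `0` on `{(1,3),(0,7)}`, else `1`. -/
def LK (k : ℤ × ℤ) : ℤ := if k = (1, 3) ∨ k = (0, 7) then 0 else 1

/-- Local 8-torsion digit `θ = t − 2 = [d ≡ 3 (8)]` (tree: `DyadicTorsion.padicValNat_card_torsion_two_of_smul_eq_quadraticTwist`). -/
def θ (k : ℤ × ℤ) : ℤ := if k = (1, 3) then 1 else 0

/-- **THE TABLE.** -/
theorem eC_values :
    eC (1, 3) = -2 ∧ eC (1, 7) = 0 ∧ eC (0, 1) = 0 ∧ eC (0, 3) = 0 ∧ eC (0, 5) = 0 ∧ eC (0, 7) = -1 := by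
  decide

/-- The memo shape resolved: `e_C = LK − 1 − θ` on every key (so the memo's `τ_v` is `θ`, and it sits in F1, `e₁ = 2 − t`). -/
theorem eC_eq_LK_sub : ∀ k ∈ key6, eC k = LK k - 1 - θ k := by decide

/-- **AUDIT LAW, GLOBAL FORM: `e_C + E = 0` on ALL six keys** (k3-g17's law asked only for constancy within each depth class). -/
theorem eC_add_E : ∀ k ∈ key6, eC k + E k = 0 := by decide

/-- **`Δ_C = 2`** (k3-g17's prediction; the fork `eta13_of_DeltaC` then reads `η(1,3) = η(1,7)`). -/
theorem DeltaC_eq_two : eC (1, 7) - eC (1, 3) = 2 := by decide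

/-- The argmax of `e_C + E` in each depth class is EVERY key (all tie at `0`). -/
theorem argmax_ties : ∀ k ∈ key6, ∀ k' ∈ key6, eC k + E k = eC k' + E k' := by decide

/-- The in-tree BSD₂ anchors `cm7^{(d₀)}`, `d₀ ∈ {−1, 2, −2}`, sit on keys `(1,7)`, `(0,1)`, `(0,7)` — one odd, two even. -/
theorem anchor_keys : key (-1) = (1, 7) ∧ key 2 = (0, 1) ∧ key (-2) = (0, 7) := by decide

/-- k3-g17's proposed new anchors are on `(1,3)` (`d₀ = −5`) and `(0,7)` (`d₀ = −34`); with `argmax_ties` they are optional. -/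
theorem k3g17_anchor_keys : key (-5) = (1, 3) ∧ key (-34) = (0, 7) := by decide

/-- Every class parameter lands in `key6` (`d` squarefree forces `4 ∤ d`; here only `d % 4 ≠ 0, 1` is used). -/
theorem key_mem_key6 (d : ℤ) (hd4 : d % 4 ≠ 1) (hd0 : d % 4 ≠ 0) : key d ∈ key6 := by
  unfold key key6
  rcases (by omega : d % 2 = 1 ∨ d % 2 = 0) with h | h
  · rw [h, show (2 : ℤ) - 1 = 1 by norm_num, Int.ediv_one]
    have : d % 8 = 3 ∨ d % 8 = 7 := by omega
    rcases this with h8 | h8 <;> simp [h8]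
  · rw [h, sub_zero]
    have : d / 2 % 8 = 1 ∨ d / 2 % 8 = 3 ∨ d / 2 % 8 = 5 ∨ d / 2 % 8 = 7 := by omega
    rcases this with h8 | h8 | h8 | h8 <;> simp [h8]

/-! ## Part C — member and anchor glue with the calibration `e_C + E = 0` (valuation shadow over `ℤ`, `omega`) -/

section Glue

variable {A B g m n n' eA eCk Ek η : ℤ}

/-- **LOWER ⟸ `0 ≤ e_A`.** S2′-lower, T1⁻, S3d⁻, S3c (any form giving `n ≤ B + g + e_C(k)`), calibration `e_C(k) + E(k) = 0`. -/
theorem lower_of_eA_nonneg (hS2 : 2 * (A + g) + eA ≤ m) (hT1 : m ≤ 2 * n') (hS3d : n' ≤ n + Ek)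
    (hS3c : n ≤ B + g + eCk) (hcal : eCk + Ek = 0) (hA : 0 ≤ eA) : A ≤ B := by
  omega

/-- The budget's exact residual: `2A + e_A ≤ 2B` — every key-dependent ALGEBRAIC digit has cancelled. -/
theorem two_A_add_eA_le (hS2 : 2 * (A + g) + eA ≤ m) (hT1 : m ≤ 2 * n') (hS3d : n' ≤ n + Ek)
    (hS3c : n ≤ B + g + eCk) (hcal : eCk + Ek = 0) : 2 * A + eA ≤ 2 * B := by
  omega

/-- With the calibration, the FLOOR of record `2 (e_C + E) ≤ e_A` IS the sign condition `0 ≤ e_A`. -/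
theorem floor_iff_eA_nonneg (hcal : eCk + Ek = 0) : 2 * (eCk + Ek) ≤ eA ↔ 0 ≤ eA := by
  omega

/-- When S2′, T1 (up to junk `η ≥ 0`: `m + 2η = 2n′`) and S3d are EXACT at a member, LOWER ⟺ `2η ≤ e_A + 2(B − A)`… in particular
at a BSD₂-exact ANCHOR (`A = B`) the analytic digit is READ OFF as `e_A = −2η`. -/
theorem eA_eq_neg_two_eta_of_anchor (hS2 : m = 2 * (A + g) + eA) (hT1 : m + 2 * η = 2 * n') (hS3d : n' = n + Ek)
    (hS3c : n = B + g + eCk) (hcal : eCk + Ek = 0) (hBSD : A = B) : eA = -2 * η := by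
  omega

/-- Hence at an anchor: `0 ≤ e_A ⟺ η = 0 ⟺ e_A = 0` (junk-free ⟺ FLOOR, and then the digit is exactly `0`). -/
theorem anchor_trichotomy (hS2 : m = 2 * (A + g) + eA) (hT1 : m + 2 * η = 2 * n') (hS3d : n' = n + Ek)
    (hS3c : n = B + g + eCk) (hcal : eCk + Ek = 0) (hBSD : A = B) (hη : 0 ≤ η) :
    (0 ≤ eA ↔ η = 0) ∧ (η = 0 ↔ eA = 0) := by
  constructor <;> omega

/-- Conversely, if all four steps are exact at a member, LOWER is EQUIVALENT to `−2(B − A) ≤ e_A`; so `0 ≤ e_A` is the weakest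
KEY-FREE sufficient condition, and it is necessary wherever BSD₂ holds (`A = B`). -/
theorem lower_iff_of_exact (hS2 : m = 2 * (A + g) + eA) (hT1 : m = 2 * n') (hS3d : n' = n + Ek)
    (hS3c : n = B + g + eCk) (hcal : eCk + Ek = 0) : A ≤ B ↔ 0 ≤ eA + 2 * (B - A) := by
  omega

end Glue

/-! ## Part D — the two-anchor economy WITHOUT argmax: any junk-free anchor per depth class -/

/-- 2-adic depth class of a key: `2` on odd keys, `3` on even keys. -/
def depth (k : ℤ × ℤ) : ℤ := if k.1 = 1 then 2 else 3

/-- EA-n (k3-g17 K2 / R136): the analytic digit factors through the depth class. -/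
def DepthOnly (eA : ℤ × ℤ → ℤ) : Prop :=
  ∀ k ∈ key6, ∀ k' ∈ key6, depth k = depth k' → eA k = eA k'

/-- Under EA-n, `e_A = 0` at ONE key per depth class gives `e_A = 0` — hence FLOOR — on all six keys; with `argmax_ties` the two
keys are ARBITRARY, e.g. the in-tree anchor keys `(1,7)` (`d₀ = −1`) and `(0,1)` (`d₀ = 2`). -/
theorem eA_zero_all_of_two_anchors {eA : ℤ × ℤ → ℤ} (hD : DepthOnly eA) {k₂ k₃ : ℤ × ℤ}
    (hk₂ : k₂ ∈ key6) (hk₃ : k₃ ∈ key6) (hd₂ : depth k₂ = 2) (hd₃ : depth k₃ = 3)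
    (h₂ : eA k₂ = 0) (h₃ : eA k₃ = 0) : ∀ k ∈ key6, eA k = 0 := by
  intro k hk
  have hdk : depth k = 2 ∨ depth k = 3 := by unfold depth; split_ifs <;> simp
  rcases hdk with h | h
  · rw [hD k hk k₂ hk₂ (h.trans hd₂.symm), h₂]
  · rw [hD k hk k₃ hk₃ (h.trans hd₃.symm), h₃]

/-- … and then the FLOOR of record holds on every key. -/
theorem floor_all_of_two_anchors {eA : ℤ × ℤ → ℤ} (hD : DepthOnly eA) {k₂ k₃ : ℤ × ℤ}
    (hk₂ : k₂ ∈ key6) (hk₃ : k₃ ∈ key6) (hd₂ : depth k₂ = 2) (hd₃ : depth k₃ = 3)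
    (h₂ : eA k₂ = 0) (h₃ : eA k₃ = 0) : ∀ k ∈ key6, 2 * (eC k + E k) ≤ eA k := by
  intro k hk
  have h1 := eC_add_E k hk
  have h2 := eA_zero_all_of_two_anchors hD hk₂ hk₃ hd₂ hd₃ h₂ h₃ k hk
  omega

/-- The in-tree anchor keys have the two depths. -/
theorem anchor_depths : depth (key (-1)) = 2 ∧ depth (key 2) = 3 ∧ depth (key (-2)) = 3 := by decide

/-- WITHOUT EA-n: FLOOR on all keys is exactly the sign table `0 ≤ e_A(k)` — the single residual question of the LOWER half. -/
theorem floor_all_iff_sign (eA : ℤ × ℤ → ℤ) : (∀ k ∈ key6, 2 * (eC k + E k) ≤ eA k) ↔ ∀ k ∈ key6, 0 ≤ eA k := by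
  constructor
  · intro h k hk; have := h k hk; rw [eC_add_E k hk] at this; omega
  · intro h k hk; rw [eC_add_E k hk]; have := h k hk; omega

/-! ## Part E — R134 is in the tree (budget content): `t = 2 + θ`, by name -/

/-- `v₂ #W(ℚ₂)_tors = 3` iff `d ≡ 3 (8)`, else `2`, for every globally minimal member — the θ of `eC_eq_LK_sub`, BY NAME. -/
example := @DyadicTorsion.padicValNat_card_torsion_two_of_smul_eq_quadraticTwist

/-- … and `key = (1,3)` iff `d ≡ 3 (8)` (tree `RestrictedSelmerPair.key_eq_one_three_iff`), BY NAME. -/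
example := @RestrictedSelmerPair.key_eq_one_three_iff

end Summit.BirchSwinnertonDyer.BirchSwinnertonDyer.Cruxes.SplitBadTwoLowerHalfOfFacts.StubIdeasK1G19

end
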